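import Summits.BirchSwinnertonDyer.BirchSwinnertonDyer.Theorems.ByReductionTypeAtTwoRankOneAtTwoOneDoorLawFirstLayerDefs
import Literature.NumberTheory.EllipticCurves.ModularParametrizationDegree
import Literature.NumberTheory.EllipticCurves.HeegnerPointsOfConductor
import Summits.BirchSwinnertonDyer.BirchSwinnertonDyer.Theorems.ByReductionTypeAtTwoRankOneAtTwoBigImageOddLocalOneDoorExponentCovariance
import HarnessLib

/-!
# Route ByReductionTypeAtTwo, crux `RankOneAtTwoBigImageOddLocal` (stmt-BirchSwinnertonDyer-23715), line `one_door_analytic`: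
# THE SCALED PARAMETRISATION DATUM `k • Dt` EXISTS (modulo the printed existence of the modular degree) — REF1 §152's doubling
# mutation is constructible for EVERY datum

Lead prover seat `bsd-line-fkl-p1` g19 (2026-08-29).  THEOREMS ONLY (standard axioms; no `def`, no named fact introduced, no `sorry`).  CONDITIONAL
by design on ONE printed fact, the tree's `ModularForms.exists_modularDegree` (a non-constant holomorphic map of compact Riemann surfaces has a degree;
Diamond–Shurman §3.1, Farkas–Kra Prop. I.1.6 — the same leaf through which the tree derives `nonempty_modularParametrizationData`).  Helper file
`--supports stmt-BirchSwinnertonDyer-23715`; it does not close the crux and BSD is not proved by any of this.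

A `ModularParametrizationData W N` pins its constant `c` only by `c·Λ_f ⊆ Λ_E` (REF1 §152 A4).  REF1's kills E-152-A (ES-24c / ES-24t as typed in Sketch24)
and E-156-A used the DOUBLED datum `(f, L, uniformize, 2c, 4·deg)` modulo the constructibility of its degree clause (`DoubledDegSpec Dt`, taken as a
hypothesis in `HOME/REF1-data/b152/lean/Probe152.lean`).  Here, for EVERY datum `Dt` and EVERY integer `k ≠ 0`:

* `exists_scaled_datum` — modulo `exists_modularDegree` there is a datum `Dt'` of the same `W` and level with the same newform, `Dt'.c = k·Dt.c` and
  `φ_{Dt'} = k • φ_{Dt}` pointwise on `ℍ` (the degree clause of `Dt'` is the printed degree of `τ ↦ k c·2πi∫f (mod Λ_E)`, transported along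
  `ℂ/Λ_E ≃ E(ℂ)` exactly as in the tree's `nonempty_modularParametrizationData_of`);
* `exists_scaled_datum_heegnerPointComplex` — hence with `heegnerPointComplex Dt' H = k • heegnerPointComplex Dt H` for every Heegner datum `H`
  (and every complex Heegner point of every conductor, `heegnerPointComplexOfConductor`).
Together with `…OneDoorExponentCovariance.lean` (`heegnerExponent_conclusion_iff_of_scaled`): the floating-exponent stub R₀⁺ / route item 23932 takes the
SAME truth value at `Dt` and at `k • Dt` — rescaling neither refutes nor proves it; and REF1's doubling witnesses are constructible modulo print.
-/

set_option autoImplicit false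
set_option linter.dupNamespace false

noncomputable section

open scoped Classical

namespace Summit.BirchSwinnertonDyer.BirchSwinnertonDyer.Theorems.RankOneAtTwoOneDoor

open WeierstrassCurve NumberField UpperHalfPlane
open Literature.NumberTheory.EllipticCurves Literature.NumberTheory.EllipticCurves.ModularForms

variable {W : WeierstrassCurve ℚ} {N : ℕ} [NeZero N]

/-- **The scaled datum `k • Dt` exists** (modulo the printed existence of the modular degree `exists_modularDegree`): same newform, lattice and
uniformisation, constant `k·c`, parametrisation `k • φ`.  [cite: DiamondShurman2005, §3.1 (degree of a map of compact Riemann surfaces)]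
[cite: CremonaAlgorithms1997, §2.10] -/
theorem exists_scaled_datum (hb : exists_modularDegree) (Dt : ModularParametrizationData W N) {k : ℤ} (hk : k ≠ 0) :
    ∃ Dt' : ModularParametrizationData W N, Dt'.f = Dt.f ∧ Dt'.c = k * Dt.c ∧ ∀ τ : ℍ, Dt'.φ τ = k • Dt.φ τ := by
  -- `k c Λ_f ⊆ Λ_E`
  have hc' : ∀ z ∈ periodLattice Dt.f, ((k * Dt.c : ℤ) : ℂ) * z ∈ Dt.L.lattice := fun z hz => by
    have h := Dt.smul_periodLattice_le z hz
    have e : ((k * Dt.c : ℤ) : ℂ) * z = (k : ℤ) • ((Dt.c : ℂ) * z) := by rw [zsmul_eq_mul]; push_cast; ring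
    rw [e]
    exact Dt.L.lattice.smul_mem k h
  have hc0 : ((k * Dt.c : ℤ) : ℂ) ≠ 0 := Int.cast_ne_zero.mpr (mul_ne_zero hk Dt.maninConstant_ne_zero_holds)
  obtain ⟨d, hd, hfin⟩ := hb Dt.isNewformOf.1.ne_zero hc0 hc'
  -- transport the degree clause along `ℂ/Λ_E ≃ E(ℂ)`
  have hker' : Dt.L.lattice.toAddSubgroup = Dt.uniformize.ker :=
    SetLike.coe_injective (by rw [Submodule.coe_toAddSubgroup, Dt.ker_uniformize])
  let e : ℂ ⧸ Dt.L.lattice.toAddSubgroup ≃+ (W.baseChange ℂ).toAffine.Point :=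
    QuotientAddGroup.liftEquiv Dt.L.lattice.toAddSubgroup Dt.uniformize_surjective hker'
  have he : ∀ x : ℂ, e.toEquiv (x : ℂ ⧸ Dt.L.lattice.toAddSubgroup) = Dt.uniformize x := fun _ ↦ rfl
  have key := (finite_setOf_card_fiberOrbits_ne_iff e.toEquiv
    (fun τ : ℍ ↦ ((((k * Dt.c : ℤ) : ℂ) * eichlerIntegral Dt.f τ : ℂ) : ℂ ⧸ Dt.L.lattice.toAddSubgroup)) d).mpr hfin
  simp only [he] at key
  refine ⟨{ f := Dt.f
            isNewformOf := Dt.isNewformOf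
            L := Dt.L
            isNeronLattice := Dt.isNeronLattice
            uniformize := Dt.uniformize
            ker_uniformize := Dt.ker_uniformize
            uniformize_surjective := Dt.uniformize_surjective
            uniformize_spec := Dt.uniformize_spec
            c := k * Dt.c
            smul_periodLattice_le := hc'
            deg := d
            deg_pos := hd
            deg_spec := key }, rfl, rfl, fun τ => ?_⟩
  show Dt.uniformize (((k * Dt.c : ℤ) : ℂ) * eichlerIntegral Dt.f τ) = k • Dt.uniformize ((Dt.c : ℂ) * eichlerIntegral Dt.f τ)
  rw [← map_zsmul, zsmul_eq_mul]
  push_cast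
  rw [mul_assoc]

/-- **The scaled datum scales every Heegner point**: modulo `exists_modularDegree`, for every datum `Dt` and `k ≠ 0` there is a datum `Dt'` with
`Dt'.c = k·Dt.c`, `heegnerPointComplex Dt' H = k • heegnerPointComplex Dt H` for every Heegner datum `H` (door points) and
`heegnerPointComplexOfConductor Dt' D β n = k • heegnerPointComplexOfConductor Dt D β n` for all `D β n` (the Kolyvagin tower).  At `k = 2` this is REF1
§152's doubling witness, now constructible modulo print. [cite: DiamondShurman2005, §3.1] [cite: GrossLMS1991, §3] -/
theorem exists_scaled_datum_heegnerPointComplex (hb : exists_modularDegree) (Dt : ModularParametrizationData W N) {k : ℤ} (hk : k ≠ 0) :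
    ∃ Dt' : ModularParametrizationData W N, Dt'.c = k * Dt.c ∧
      (∀ {D : ℤ} (H : HeegnerDatum N D), heegnerPointComplex Dt' H = k • heegnerPointComplex Dt H) ∧
      (∀ (D β : ℤ) (n : ℕ), heegnerPointComplexOfConductor Dt' D β n = k • heegnerPointComplexOfConductor Dt D β n) := by
  obtain ⟨Dt', -, hc, hφ⟩ := exists_scaled_datum hb Dt hk
  refine ⟨Dt', hc, fun H => ?_, fun D β n => ?_⟩
  · simp only [heegnerPointComplex, hφ, Finset.smul_sum]
  · unfold heegnerPointComplexOfConductor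
    exact hφ _

/-! ### APPEND #1 (lead `bsd-line-fkl-p1` g19, 2026-08-29T02:5xZ) — THE HEADLINE: R₀⁺ has the same truth value at `Dt` and at `k • Dt` -/

/-- **R₀⁺ / item 23932 is SCALE-INVARIANT (kernel form of cdisprove 23932 F2 and of REF1 §152 A4 for this statement).**  Modulo the printed existence of the
modular degree (`exists_modularDegree`): for `K` imaginary quadratic with the Heegner hypothesis for `N`, every datum `Dt` of `W` at level `N` and every
integer `k ≠ 0`, there is a datum `Dt'` with `Dt'.c = k·Dt.c` whose Heegner points are `k •` those of `Dt`, and the conclusion of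
`HeegnerExponentAtSelmerTrivialMinimalDoorAtTwo` («every `K`-rational door point has exact exponent `v₂(c)`») holds for `Dt'` IFF it holds for `Dt`
(`exists_scaled_datum_heegnerPointComplex` + `heegnerExponent_conclusion_iff_of_scaled`).  So no rescaling of a datum refutes or proves R₀⁺; its content
sits at one datum per curve and level. [cite: DiamondShurman2005, §3.1] [cite: Darmon2004, Thm. 3.6] -/
theorem exists_scaled_datum_heegnerExponent_conclusion_iff (hb : exists_modularDegree) {K : Type} [Field K] [NumberField K] [W.IsElliptic]
    (hK : IsImaginaryQuadratic K) (hHN : SatisfiesHeegnerHypothesis N K) (Dt : ModularParametrizationData W N) {k : ℤ} (hk : k ≠ 0) :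
    ∃ Dt' : ModularParametrizationData W N, Dt'.c = k * Dt.c ∧
      (∀ {D : ℤ} (H : HeegnerDatum N D), heegnerPointComplex Dt' H = k • heegnerPointComplex Dt H) ∧
      ((∀ (H : HeegnerDatum N (NumberField.discr K)) (ι : K →+* ℂ) (P : (W.baseChange K).toAffine.Point),
          WeierstrassCurve.Affine.Point.map ι.toRatAlgHom P = heegnerPointComplex Dt' H →
            HasTwoDivisibilityUpToTorsion W K P (padicValInt 2 Dt'.c)) ↔
        (∀ (H : HeegnerDatum N (NumberField.discr K)) (ι : K →+* ℂ) (P : (W.baseChange K).toAffine.Point),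
          WeierstrassCurve.Affine.Point.map ι.toRatAlgHom P = heegnerPointComplex Dt H →
            HasTwoDivisibilityUpToTorsion W K P (padicValInt 2 Dt.c))) := by
  obtain ⟨Dt', hc, hH, -⟩ := exists_scaled_datum_heegnerPointComplex hb Dt hk
  exact ⟨Dt', hc, hH, heegnerExponent_conclusion_iff_of_scaled hK hHN Dt Dt' hk hc fun H => hH H⟩

end Summit.BirchSwinnertonDyer.BirchSwinnertonDyer.Theorems.RankOneAtTwoOneDoor

end
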